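import Mathlib.GroupTheory.GroupAction.ConjAct
import Mathlib.GroupTheory.QuotientGroup.Basic
import Mathlib.GroupTheory.Subgroup.Center
import Mathlib.Topology.Algebra.Group.Basic
import Mathlib.FieldTheory.KrullTopology
import Mathlib.Data.Nat.Prime.Basic
import HarnessLib

/-!
# [IUTchI] §3, Remarks 3.1.1, 3.1.3, 3.1.6, 3.1.7 (iv) (remarks to Definition 3.1, initial Θ-data)

S. Mochizuki, *Inter-universal Teichmüller theory I: construction of Hodge theaters*, §3
"Chains of Θ-Hodge theaters", kurims final manuscript (May 2020) pp. 63–69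
[claim: Mochizuki2012, status: disputed].  One `/-! -/` section per Remark; the checkable
content is typed as real definitions / `Prop`-valued statements (nothing of the series is asserted),
pure prose is indexed in the section docstring (status "noted").  Remarks 3.1.2, 3.1.4, 3.1.5 and
3.1.7 (i)–(iii) belong to the owner of Definition 3.1 (`InitialThetaData`, `KappaCoricFunctions`,
seat abc-iut-L5-t2) and are NOT here.

## What is typed here

* **Rmk 3.1.1** (p. 63): noted — the tempered fundamental groups `Π^tp_{(−)v}`, `Δ^tp_{(−)v}` at
  `v ∈ V^non` and the identification of their profinite completions with `Π_{(−)v}`, `Δ_{(−)}` are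
  exactly the fields of the tempered-π₁ interface `TemperedArithmeticGroup` of
  `Literature.AnabelianGeometry.SemiGraphs.TemperedCurves` ([SemiAnbd] Ex. 3.10; seat
  abc-iut-L3-t2); nothing is re-declared (TODO-merge:abc-iut-L3-t2 TemperedArithmeticGroup).
* **Rmk 3.1.3** (p. 65): the two "completely determined by" claims, typed as predicates on the
  SHAPE of a 7-tuple of initial Θ-data (`ThetaDataShape`) relative to an abstract admissibility
  predicate (to be instantiated by `InitialThetaData`, TODO-merge:abc-iut-L5-t2 Def 3.1) — we use
  Mathlib's `Function.FactorsThrough` reading of "determined by".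
* **Rmk 3.1.6** (p. 66): the erratum to [EtTh] (odd `l`), indexed; its one checkable consequence
  for the present series — Def 3.1 (c) has `l ≥ 5` prime, hence odd — PROVED (`odd_of_five_le`).
* **Rmk 3.1.7 (iv)** (pp. 68–69): for a topological group `G` ("`Gal(L̄_C/L_C)`") and a normal
  subgroup `N` ("`Gal(L̄_C/L_C(κ-sol))`"): *κ-sol-open* subgroups of `N`, the subgroups
  `Aut_{κ-sol}(N) ⊆ Aut(N)`, `Out_{κ-sol}(N) ⊆ Out(N)`, the conjugation square
  `G → Aut_{κ-sol}(N)`, `G/N → Out_{κ-sol}(N)` (commutativity PROVED), and the final observation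
  "`N` center-free ⇒ the square is cartesian" PROVED as abstract group theory
  (`KappaSol.toPullback_bijective`).  The center-freeness of the specific `N` (via Lemma 2.7
  (vi), (vii) and [NodNon] Thm. C) is a deep input: typed as the field-theoretic predicate
  `KappaSol.CenterFree` on an intermediate field `L_C ⊆ M ⊆ L̄_C`, not asserted.  The natural
  profinite topologies on `Aut_{κ-sol}`/`Out_{κ-sol}` and the continuity of the square are typed as
  the statement `KappaSol.ConjContinuous` (conjugation `G × N → N` is continuous — provable, left as
  a statement since the printed topology on `Aut_{κ-sol}` is the one induced by the finite quotients).
-/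

namespace Literature.IUT.HodgeTheaters

open _root_.Topology

universe u v

/-! ## Remark 3.1.1 ([IUTchI] Rmk 3.1.1 p.63) — noted

"Relative to the notation of Definition 3.1, (e), suppose that `v ∈ V^non`.  Then in addition to the
various profinite groups `Π_{(−)v}`, `Δ_{(−)}`, one also has corresponding tempered fundamental
groups `Π^tp_{(−)v}`; `Δ^tp_{(−)v}` [cf. [André], §4; [SemiAnbd], Example 3.10], whose profinite
completions may be identified with `Π_{(−)v}`, `Δ_{(−)}`.  Here, we note that unlike "`Δ_{(−)}`", the
topological group `Δ^tp_{(−)v}` depends, a priori, on `v`."  — Notation-setting; the objects and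
the completion identification are the interface `TemperedArithmeticGroup K` (fields `Pi`, `toHat`,
`PiHat`, …) of the [SemiAnbd] Ex. 3.10 file owned by abc-iut-L3-t2.  Status: noted. -/

/-! ## Remark 3.1.3 ([IUTchI] Rmk 3.1.3 p.65)

"Since `V^bad_mod ≠ ∅`, it follows immediately from Definition 3.1, (d), (e), (f), that the data
`(F/F̄, X_F, l, C_K, V, V^bad_mod, ε)` is, in fact, completely determined by the data
`(F/F̄, X_F, C_K, V, V^bad_mod)`, and that `C_K` is completely determined up to `K`-isomorphism by
the data `(F/F̄, X_F, l, V)`.  Finally, we remark that for given data `(X_F, l, V^bad_mod)`, distinct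
choices of "`V`" will not affect the theory in any significant way." (last sentence: prose, noted) -/

/-- The SHAPE of a 7-tuple of initial Θ-data `(F/F̄, X_F, l, C_K, V, V^bad_mod, ε)` ([IUTchI]
Def. 3.1), with abstract component types; the admissibility conditions (a)–(f) of Def. 3.1 are NOT
here — they are the predicate `Adm` the statements below quantify over
(TODO-merge:abc-iut-L5-t2 Def 3.1 `InitialThetaData`). [claim: Mochizuki2012, status: disputed] -/
structure ThetaDataShape (𝔽 𝕏 𝕃 ℭ 𝕍 𝔅 𝔈 : Type*) where
  /-- "`F/F̄`": the number field with an algebraic closure -/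
  F : 𝔽
  /-- "`X_F`": the once-punctured elliptic curve -/
  XF : 𝕏
  /-- "`l`": the prime -/
  l : 𝕃
  /-- "`C_K`": the `K`-core orbicurve of type `(1, l-tors)±` -/
  CK : ℭ
  /-- "`V ⊆ V(K)`" -/
  V : 𝕍
  /-- "`V^bad_mod`" -/
  VbadMod : 𝔅
  /-- "`ε`": the cusp -/
  eps : 𝔈

namespace ThetaDataShape

variable {𝔽 𝕏 𝕃 ℭ 𝕍 𝔅 𝔈 : Type*}

/-- Rmk 3.1.3, first claim, as a predicate on an admissibility condition `Adm` ("is a collection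
of initial Θ-data", Def. 3.1 (a)–(f)): on admissible tuples, the whole tuple is a function of
`(F/F̄, X_F, C_K, V, V^bad_mod)` (Mathlib `Function.FactorsThrough`).
[claim: Mochizuki2012, status: disputed] -/
def DeterminedByFive (Adm : ThetaDataShape 𝔽 𝕏 𝕃 ℭ 𝕍 𝔅 𝔈 → Prop) : Prop :=
  Function.FactorsThrough (fun D : {D // Adm D} => D.1)
    (fun D : {D // Adm D} => (D.1.F, D.1.XF, D.1.CK, D.1.V, D.1.VbadMod))

/-- Rmk 3.1.3, second claim: on admissible tuples, `C_K` is a function of `(F/F̄, X_F, l, V)` up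
to `K`-isomorphism — `KIso` the abstract "`K`-isomorphic" relation on the `C_K`-component.
[claim: Mochizuki2012, status: disputed] -/
def CKDeterminedUpToIso (Adm : ThetaDataShape 𝔽 𝕏 𝕃 ℭ 𝕍 𝔅 𝔈 → Prop) (KIso : ℭ → ℭ → Prop) :
    Prop :=
  ∀ D D' : ThetaDataShape 𝔽 𝕏 𝕃 ℭ 𝕍 𝔅 𝔈, Adm D → Adm D' →
    D.F = D'.F → D.XF = D'.XF → D.l = D'.l → D.V = D'.V → KIso D.CK D'.CK

/-- Unfolding of `DeterminedByFive`: two admissible tuples with the same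
`(F/F̄, X_F, C_K, V, V^bad_mod)` are equal. [claim: Mochizuki2012, status: disputed] -/
theorem determinedByFive_iff (Adm : ThetaDataShape 𝔽 𝕏 𝕃 ℭ 𝕍 𝔅 𝔈 → Prop) :
    DeterminedByFive Adm ↔ ∀ D D', Adm D → Adm D' →
      D.F = D'.F → D.XF = D'.XF → D.CK = D'.CK → D.V = D'.V → D.VbadMod = D'.VbadMod → D = D' := by
  constructor
  · intro h D D' hD hD' h1 h2 h3 h4 h5
    have := @h ⟨D, hD⟩ ⟨D', hD'⟩ (by simp [h1, h2, h3, h4, h5])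
    simpa using this
  · rintro h ⟨D, hD⟩ ⟨D', hD'⟩ hx
    simp only [Prod.mk.injEq] at hx
    exact h D D' hD hD' hx.1 hx.2.1 hx.2.2.1 hx.2.2.2.1 hx.2.2.2.2

end ThetaDataShape

/-! ## Remark 3.1.6 ([IUTchI] Rmk 3.1.6 p.66) — erratum to [EtTh], indexed

"… we take the opportunity to correct an unfortunate — albeit in fact irrelevant! — error in
[EtTh].  In the discussion preceding [EtTh], Definition 2.1, one must in fact assume that the integer
`l` is odd in order for the quotient `Δ_X` to be well-defined.  Since, ultimately, in [EtTh] … as well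
as in the present series of papers, this is the only case that is of interest, this oversight does
not affect either the present series of papers or the bulk of the remainder of [EtTh]. … Thus,
[EtTh], Remark 2.2.1, must be deleted; in [EtTh], Proposition 2.12, one must in fact exclude the
case where the orbicurve under consideration is "`Ċ`". …"  The errata themselves concern the [EtTh]
files (Literature/AnabelianGeometry/EtaleTheta, layer L2) and are recorded there by their owners;
here we prove the one consequence used by the present series: Def. 3.1 (c) requires `l ≥ 5` prime,
so `l` is odd. -/

/-- Rmk 3.1.6, "this is the only case that is of interest": a prime `l ≥ 5` (Def. 3.1 (c)) is odd,
so the oddness hypothesis needed for [EtTh]'s `Δ_X` holds throughout the series. PROVED.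
[claim: Mochizuki2012, status: disputed] -/
theorem odd_of_five_le {l : ℕ} (hl : l.Prime) (h5 : 5 ≤ l) : Odd l :=
  hl.odd_of_ne_two (by omega)

/-! ## Remark 3.1.7 (iv) ([IUTchI] Rmk 3.1.7 (iv) pp.68–69)

Notation of (iii): `L = F_mod`, `L̄ = F̄`, `L_C` the function field of `C_{F_mod}`, `L̄_C` an algebraic
closure, `L_C(κ-sol) ⊆ L̄_C` the subfield generated by the `κ`-solvable elements.  "Consider the
tautological exact sequence of Galois groups
`1 → Gal(L̄_C/L_C(κ-sol)) → Gal(L̄_C/L_C) → Gal(L_C(κ-sol)/L_C) → 1`.  Let us refer to a subgroup of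
`Gal(L̄_C/L_C(κ-sol))` as a *κ-sol-open subgroup* if it is the intersection with `Gal(L̄_C/L_C(κ-sol))`
of a normal open subgroup of `Gal(L̄_C/L_C)`.  Thus, the subgroups
`Aut_{κ-sol}(…) ⊆ Aut(…)`, `Out_{κ-sol}(…) ⊆ Out(…)` of automorphisms/outer automorphisms of the
topological group `Gal(L̄_C/L_C(κ-sol))` that preserve each κ-sol-open subgroup … admit natural
compatible homomorphisms `Aut_{κ-sol} → Aut(Q)`, `Out_{κ-sol} → Out(Q)` for each quotient `… ↠ Q` by a
κ-sol-open subgroup.  The kernels of these … determine natural profinite topologies …, with respect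
to which each arrow of the commutative diagram
`Gal(L̄_C/L_C) → Aut_{κ-sol}(…)`, `Gal(L_C(κ-sol)/L_C) → Out_{κ-sol}(…)` that arises, via conjugation,
from the exact sequence considered above is continuous.  Finally, we observe that
`Gal(L̄_C/L_C(κ-sol))` is center-free; in particular, the above commutative diagram … is cartesian."

We type this for an arbitrary topological group `G` with a normal subgroup `N` (the exact sequence
`1 → N → G → G/N → 1`). -/

namespace KappaSol

variable {G : Type u} [Group G] (N : Subgroup G)

section Topological

variable [TopologicalSpace G]

/-- A subgroup `H ⊆ N` is *κ-sol-open* if "it is the intersection with `N` of a normal open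
subgroup of `G`" (Rmk 3.1.7 (iv), p. 68). [claim: Mochizuki2012, status: disputed] -/
def IsKSolOpen (H : Subgroup N) : Prop :=
  ∃ U : Subgroup G, U.Normal ∧ IsOpen (U : Set G) ∧ H = U.subgroupOf N

/-- An automorphism `φ` of `N` *preserves* the subgroup `H` (setwise: `φ(H) = H`).
[claim: Mochizuki2012, status: disputed] -/
def Preserves (φ : MulAut N) (H : Subgroup N) : Prop := ∀ x : N, φ x ∈ H ↔ x ∈ H

/-- `Aut_{κ-sol}(N) ⊆ Aut(N)`: "automorphisms of the topological group `N` that preserve each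
κ-sol-open subgroup" (Rmk 3.1.7 (iv), pp. 68–69); automorphisms of the topological group = group
automorphisms that are homeomorphisms. [claim: Mochizuki2012, status: disputed] -/
def aut : Subgroup (MulAut N) where
  carrier := {φ | Continuous φ ∧ Continuous φ.symm ∧ ∀ H : Subgroup N, IsKSolOpen N H → Preserves N φ H}
  one_mem' := by
    refine ⟨?_, ?_, fun H _ x => Iff.rfl⟩
    · simpa [MulAut.one_def] using continuous_id
    · simpa [MulAut.one_def] using continuous_id
  mul_mem' := by
    rintro φ ψ ⟨hφ, hφ', hφH⟩ ⟨hψ, hψ', hψH⟩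
    refine ⟨?_, ?_, fun H hH x => ?_⟩
    · rw [MulAut.coe_mul]; exact hφ.comp hψ
    · have : ⇑(φ * ψ).symm = ψ.symm ∘ φ.symm := by
        ext x; rfl
      rw [this]; exact hψ'.comp hφ'
    · rw [MulAut.mul_apply, hφH H hH, hψH H hH]
  inv_mem' := by
    rintro φ ⟨hφ, hφ', hφH⟩
    refine ⟨?_, ?_, fun H hH x => ?_⟩
    · simpa [MulAut.inv_def] using hφ'
    · have : ⇑φ⁻¹.symm = φ := by ext x; rfl
      rw [this]; exact hφ
    · rw [MulAut.inv_apply]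
      have h := hφH H hH (φ.symm x)
      rw [MulEquiv.apply_symm_apply] at h
      exact h.symm

variable {N} in
/-- Membership in `Aut_{κ-sol}(N)`, unfolded. [claim: Mochizuki2012, status: disputed] -/
theorem mem_aut_iff {φ : MulAut N} : φ ∈ aut N ↔
    Continuous φ ∧ Continuous φ.symm ∧ ∀ H : Subgroup N, IsKSolOpen N H → Preserves N φ H :=
  Iff.rfl

end Topological

/-- `Inn(N) ⊆ Aut(N)`: the inner automorphisms (range of `MulAut.conj`).
[claim: Mochizuki2012, status: disputed] -/
def inn : Subgroup (MulAut N) := (MulAut.conj : N →* MulAut N).range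

/-- `Inn(N)` is normal in `Aut(N)`: `φ ∘ conj(n) ∘ φ⁻¹ = conj(φ n)`.
[claim: Mochizuki2012, status: disputed] -/
instance inn_normal : (inn N).Normal := by
  refine ⟨?_⟩
  rintro _ ⟨n, rfl⟩ φ
  refine ⟨φ n, ?_⟩
  ext x
  simp only [MulAut.mul_apply, MulAut.conj_apply, map_mul, map_inv, MulAut.inv_apply,
    MulEquiv.apply_symm_apply]

/-- `Out(N) := Aut(N)/Inn(N)`, "the group of outer automorphisms" (p. 68).
[claim: Mochizuki2012, status: disputed] -/
abbrev Out : Type u := MulAut N ⧸ inn N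

/-- `Out_{κ-sol}(N) ⊆ Out(N)`: the image of `Aut_{κ-sol}(N)` ("κ-sol-outer automorphisms", p. 69).
[claim: Mochizuki2012, status: disputed] -/
def out [TopologicalSpace G] : Subgroup (Out N) := (aut N).map (QuotientGroup.mk' (inn N))

variable [N.Normal]

/-- The conjugation action `G → Aut(N)` of the exact sequence `1 → N → G → G/N → 1` lands in
`Aut_{κ-sol}(N)` when `G` is a topological group: conjugation is a homeomorphism of `N` and carries
`N ∩ U` to itself for `U` normal in `G` (Rmk 3.1.7 (iv): the upper arrow of the diagram). PROVED.
[claim: Mochizuki2012, status: disputed] -/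
theorem conjNormal_mem_aut [TopologicalSpace G] [IsTopologicalGroup G] (g : G) : MulAut.conjNormal g ∈ aut N := by
  have hc : ∀ g : G, Continuous (MulAut.conjNormal (H := N) g) := fun g => by
    refine Continuous.subtype_mk ?_ _
    exact (continuous_const.mul continuous_subtype_val).mul continuous_const
  refine ⟨hc g, ?_, ?_⟩
  · have : ⇑(MulAut.conjNormal (H := N) g).symm = MulAut.conjNormal (H := N) g⁻¹ := by
      ext x
      rw [MulAut.conjNormal_symm_apply, MulAut.conjNormal_apply, inv_inv]
    rw [this]; exact hc g⁻¹
  · rintro H ⟨U, hU, -, rfl⟩ x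
    rw [Subgroup.mem_subgroupOf, Subgroup.mem_subgroupOf, MulAut.conjNormal_apply]
    constructor
    · intro h
      have := hU.conj_mem _ h g⁻¹
      simpa [mul_assoc] using this
    · intro h
      exact hU.conj_mem _ h g

/-- The upper arrow `G → Aut_{κ-sol}(N)` of the diagram of Rmk 3.1.7 (iv) (conjugation), for a
topological group `G`. [claim: Mochizuki2012, status: disputed] -/
def conjAut [TopologicalSpace G] [IsTopologicalGroup G] : G →* aut N :=
  (MulAut.conjNormal (H := N)).codRestrict (aut N) (conjNormal_mem_aut N)

/-- Elements of `N` act by inner automorphisms: `conj_G(n)|_N = conj_N(n) ∈ Inn(N)`.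
[claim: Mochizuki2012, status: disputed] -/
theorem conjNormal_mem_inn (n : G) (hn : n ∈ N) : MulAut.conjNormal (H := N) n ∈ inn N :=
  ⟨⟨n, hn⟩, (MulAut.conjNormal_val (h := ⟨n, hn⟩)).symm⟩

/-- The lower arrow `G/N → Out(N)` of the diagram (induced by conjugation).
[claim: Mochizuki2012, status: disputed] -/
def outMap : G ⧸ N →* Out N :=
  QuotientGroup.lift N ((QuotientGroup.mk' (inn N)).comp (MulAut.conjNormal (H := N))) (by
    intro n hn
    rw [MonoidHom.mem_ker, MonoidHom.comp_apply, QuotientGroup.mk'_apply,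
      QuotientGroup.eq_one_iff]
    exact conjNormal_mem_inn N n hn)

/-- Commutativity of the conjugation square: `G → Aut(N) → Out(N)` equals `G → G/N → Out(N)`.
PROVED. [claim: Mochizuki2012, status: disputed] -/
theorem outMap_mk (g : G) :
    outMap N (QuotientGroup.mk g) = QuotientGroup.mk (MulAut.conjNormal (H := N) g) := by
  simp [outMap]

/-- The lower arrow lands in `Out_{κ-sol}(N)` for a topological group `G`. PROVED.
[claim: Mochizuki2012, status: disputed] -/
theorem outMap_mem_out [TopologicalSpace G] [IsTopologicalGroup G] (q : G ⧸ N) : outMap N q ∈ out N := by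
  obtain ⟨g, rfl⟩ := QuotientGroup.mk_surjective q
  rw [outMap_mk]
  exact ⟨_, conjNormal_mem_aut N g, rfl⟩

/-- The canonical map from `G` to the fibre product `G/N ×_{Out(N)} A` of the square
`G → A ⊆ Aut(N)`, `G/N → Out(N)`, for any subgroup `A ⊆ Aut(N)` containing the conjugations
(`A = Aut(N)`, or `A = Aut_{κ-sol}(N)` by `conjNormal_mem_aut`). [claim: Mochizuki2012, status: disputed] -/
def toPullback (A : Subgroup (MulAut N)) (hA : ∀ g : G, MulAut.conjNormal (H := N) g ∈ A) (g : G) :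
    {p : (G ⧸ N) × A // outMap N p.1 = QuotientGroup.mk (p.2 : MulAut N)} :=
  ⟨(QuotientGroup.mk g, ⟨_, hA g⟩), outMap_mk N g⟩

/-- Rmk 3.1.7 (iv), last display: "`N` is center-free; in particular, the commutative diagram …
is cartesian" — the formal implication, PROVED as abstract group theory: if `Z(N) = 1` then
`G → G/N ×_{Out(N)} A` is a bijection for every `A ⊆ Aut(N)` through which conjugation factors
(surjectivity holds unconditionally; injectivity is exactly center-freeness).
[claim: Mochizuki2012, status: disputed] -/
theorem toPullback_bijective (A : Subgroup (MulAut N))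
    (hA : ∀ g : G, MulAut.conjNormal (H := N) g ∈ A) (hZ : Subgroup.center N = ⊥) :
    Function.Bijective (toPullback N A hA) := by
  constructor
  · intro g₁ g₂ h
    simp only [toPullback, Subtype.mk.injEq, Prod.mk.injEq] at h
    obtain ⟨h1, h2⟩ := h
    rw [QuotientGroup.eq] at h1
    -- `n := g₁⁻¹ g₂ ∈ N` acts trivially on `N`, hence is central, hence trivial
    have hconj : MulAut.conjNormal (H := N) (g₁⁻¹ * g₂) = 1 := by
      rw [map_mul, map_inv, h2, inv_mul_cancel]
    have hmem : (⟨g₁⁻¹ * g₂, h1⟩ : N) ∈ Subgroup.center N := by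
      rw [Subgroup.mem_center_iff]
      intro x
      have hx := congrArg (fun φ : MulAut N => ((φ x : N) : G)) hconj
      simp only [MulAut.conjNormal_apply, MulAut.one_apply] at hx
      apply Subtype.ext
      simp only [Subgroup.coe_mul]
      calc (x : G) * (g₁⁻¹ * g₂) = (g₁⁻¹ * g₂ * x * (g₁⁻¹ * g₂)⁻¹) * (g₁⁻¹ * g₂) := by rw [hx]
        _ = g₁⁻¹ * g₂ * x := by group
    rw [hZ, Subgroup.mem_bot, Subtype.ext_iff] at hmem
    simpa [inv_mul_eq_one] using hmem
  · rintro ⟨⟨q, φ, hφ⟩, hq⟩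
    obtain ⟨g, rfl⟩ := QuotientGroup.mk_surjective q
    simp only [outMap_mk] at hq
    rw [QuotientGroup.eq] at hq
    obtain ⟨n, hn⟩ := hq
    refine ⟨g * n, ?_⟩
    simp only [toPullback, Subtype.mk.injEq, Prod.mk.injEq]
    refine ⟨QuotientGroup.mk_mul_of_mem g n.2, ?_⟩
    rw [map_mul, MulAut.conjNormal_val, hn, mul_inv_cancel_left]

/-- Rmk 3.1.7 (iv), the cartesian square as printed (with `Aut_{κ-sol}`), from center-freeness.
PROVED (corollary of `toPullback_bijective`). [claim: Mochizuki2012, status: disputed] -/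
theorem toPullback_aut_bijective [TopologicalSpace G] [IsTopologicalGroup G] (hZ : Subgroup.center N = ⊥) :
    Function.Bijective (toPullback N (aut N) (conjNormal_mem_aut N)) :=
  toPullback_bijective N _ _ hZ

/-- Rmk 3.1.7 (iv), continuity clause (typed as a statement): the conjugation action
`G × N → N` underlying the arrows `G → Aut_{κ-sol}(N)` is jointly continuous (so each arrow of the
square is continuous for the topologies induced by the finite quotients `N ↠ Q` by κ-sol-open
subgroups). [claim: Mochizuki2012, status: disputed] -/
def ConjContinuous [TopologicalSpace G] : Prop :=
  Continuous fun p : G × N => (MulAut.conjNormal (H := N) p.1 p.2 : N)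

/-- For a topological group the continuity clause holds. PROVED.
[claim: Mochizuki2012, status: disputed] -/
theorem conjContinuous [TopologicalSpace G] [IsTopologicalGroup G] : ConjContinuous N := by
  refine Continuous.subtype_mk ?_ _
  exact ((continuous_fst).mul (continuous_subtype_val.comp continuous_snd)).mul
    continuous_fst.inv

end KappaSol

/-- Rmk 3.1.7 (iv), the deep input, typed as a predicate (NOT asserted): for the function field
`K = L_C` of `C_{F_mod}`, an algebraic closure `Ω = L̄_C` and the intermediate field
`M = L_C(κ-sol)`, "`Gal(L̄_C/L_C(κ-sol))` is center-free" — printed proof: `Gal(F̄·L_C(κ-sol)/F̄·L_C)`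
is abelian, Lemma 2.7 (vi), (vii) applied to the geometric fundamental groups of the genus-zero
hyperbolic curves with function field `L_C`, and the Galois injectivity of [NodNon] Thm. C (Belyi).
Instantiate with the data of Rmk 3.1.7 (iii) (TODO-merge:abc-iut-L5-t2 `IsKappaSolvable`).
[claim: Mochizuki2012, status: disputed] -/
def KappaSol.CenterFree (K Ω : Type*) [Field K] [Field Ω] [Algebra K Ω]
    (M : IntermediateField K Ω) : Prop :=
  Subgroup.center (M.fixingSubgroup) = ⊥

end Literature.IUT.HodgeTheaters
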